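import Summits.HubbardSuperconductivity.HubbardSuperconductivity.Theorems.AposterioriCapRgSeededBrokenRegimeBoseFermiPinnedLaplacianNormBound
import Summits.HubbardSuperconductivity.HubbardSuperconductivity.Theorems.AposterioriCapRgSeededBrokenRegimeBoseFermiPinnedKernelExpansion
import Summits.HubbardSuperconductivity.HubbardSuperconductivity.Theorems.AposterioriCapRgSeededBrokenRegimeBoseFermiPinnedContractedTensor
import Summits.HubbardSuperconductivity.HubbardSuperconductivity.Theorems.AposterioriCapRgSeededBrokenRegimeBoseFermiPinnedLegKernelNormKernelPresented
import Literature.MathematicalPhysics.QuantumLattice.GrassmannLaplacianGramBound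

/-!
# The `L¹–L^∞` estimate for the bilinear term of Polchinski's equation
# (crux `SeededBrokenRegimeBoseFermiPinned` = stmt-HubbardSuperconductivity-14047, route AposterioriCapRg; supports, lead c4)

Restatement-invariant analysis layer, closing piece (registered stub `stub_legKernelNormPolchinskiBilinearLe`).
Polchinski's equation for the Wilsonian effective action (landed weakly: `hasDerivAt_apply_effAction`,
`seedFlow_hubbardEffectiveActionCT`, `scaleFlow_hubbardEffectiveActionCT`) has the right-hand side
`Δ_{Ċ} 𝒢 − ½ Σ_{X,Y} Ċ(X,Y) ∂_X𝒢 ∂_Y𝒢 + (Ż/Z)·1`.  The contraction term is estimated in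
`…LaplacianNormBound.lean`; this file estimates the BILINEAR term in the leg-weighted `L¹–L^∞` norm
`legKernelNorm wt ε` of Salmhofer's kernels `weightedKernel ε` (the norm of the route's scale report):

  `‖(Σ_{X,Y} C(X,Y) ∂_X F ∂_Y G)_{n+1}‖_{wt,ε} ≤ cD · Σ_{a+b=n+1} (a+1)(b+1) ‖F_{a+1}‖_{wt,ε} ‖G_{b+1}‖_{wt,ε}`

whenever `‖C X Y‖ ≤ wt X · wt Y · D X Y` with `ε Σ_Y D X Y ≤ cD`, `ε Σ_X D X Y ≤ cD` — one tree line costs the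
`L¹` norm of the propagator, each vertex its `L¹–L^∞` norm, and removing one leg from an antisymmetric kernel of
degree `a + 1` costs the factor `a + 1` (Salmhofer 1998, §4.1, Lemma 1; Gawȩdzki–Kupiainen 1985, §3).

Proof architecture (all ingredients landed this session as registered stubs of the crux):
* `grassmannDeriv_eq_sum_presented` — `∂_X F = Σ_a presented ((a+1) kernel F (a+1) (X, ·))` (kernel expansion
  `KernelExpansion.eq_sum_presented_kernel` + `KernelCalculus.kernel_grassmannDeriv`);
* `presented_mul_presented` (with the landed `genProd_append` of `GrassmannLaplacianGramBound.lean`) — products of presented polynomials are presented by tensor products,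
  so the bilinear term is `Σ_{a,b} presented (T_{ab})` (`bilinear_eq_sum_presented`), `T_{ab}` the `C`-contracted tensor;
* degree bookkeeping `presented_congr_deg` / `pinnedSum_congr_deg` (transport along `a + b = n + 1`), and
  `kernel_presented_of_ne` kills the blocks with `a + b ≠ n + 1`;
* per block: antisymmetrisation does not increase the norm (`LegKernelNormPresented.legKernelNorm_kernel_presented_le`),
  the tree-line estimate `stub_pinnedSumContractedTensorLe` (`ContractedTensor`), and the block bounds
  `pinnedSum_block_le` (`(a+1) · ε · ‖F_{a+1}‖`);
* `sum_ite_le_sum_ite` enlarges the degree box from `a, b ≤ |Γ|` to `a, b ≤ n + 1` (nonnegative terms).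

Sources: Salmhofer, CMP 194 (1998) 249, §4.1 Lemma 1 [`Salmhofer1998`]; Gawȩdzki–Kupiainen, CMP 102 (1985) 1, §3
[`GawedzkiKupiainen1985GrossNeveu`]; Salmhofer, *Renormalization* (1999), §4.3–4.4 [`Salmhofer1999`].  Folklore bookkeeping.
-/

set_option linter.dupNamespace false -- `Summit.<S>.<S>` doubles the summit name (tree convention)

namespace Summit.HubbardSuperconductivity.HubbardSuperconductivity.Theorems.AposterioriCapRgSeededBrokenRegimeBoseFermiPinned

open Literature.MathematicalPhysics.QuantumLattice GrassmannAlgebra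

namespace PolchinskiBilinearBound

variable {R : Type*} [CommRing R] {Γ : Type*} [DecidableEq Γ]

variable [Fintype Γ]

/-- `presented` of a finite sum of presentations. [folklore] -/
theorem presented_sum {ι : Type*} (s : Finset ι) {k : ℕ} (φ : ι → (Fin k → Γ) → R) :
    presented R (∑ i ∈ s, φ i) = ∑ i ∈ s, presented R (φ i) := by
  classical
  induction s using Finset.induction_on with
  | empty => simp [KernelExpansion.presented_zero]
  | insert i s hi ih => rw [Finset.sum_insert hi, Finset.sum_insert hi, KernelExpansion.presented_add, ih]

/-- **The product of two presented polynomials is presented by the tensor product of the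
presentations**: `(Σ_U φ(U) ψ(U)) (Σ_V χ(V) ψ(V)) = Σ_W φ(W₁) χ(W₂) ψ(W)`, `W = W₁ ⧺ W₂`. [folklore] -/
theorem presented_mul_presented {a b : ℕ} (φ : (Fin a → Γ) → R) (χ : (Fin b → Γ) → R) :
    presented R φ * presented R χ =
      presented R (fun W : Fin (a + b) → Γ => φ (fun i => W (Fin.castAdd b i)) * χ (fun j => W (Fin.natAdd a j))) := by
  rw [presented, presented, presented, Finset.sum_mul_sum, ContractedTensor.sum_pi_add]
  refine Finset.sum_congr rfl fun U _ => Finset.sum_congr rfl fun V _ => ?_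
  simp only [Fin.append_left, Fin.append_right, genProd_append, smul_mul_smul_comm]

/-- Transport of a presentation along an equality of degrees. [folklore] -/
theorem presented_congr_deg {k k' : ℕ} (h : k = k') (φ : (Fin k → Γ) → R) :
    presented R φ = presented R (fun W : Fin k' → Γ => φ (fun i => W (Fin.cast h i))) := by
  subst h; rfl

/-- Transport of a pinned weighted sum along an equality of degrees. [folklore] -/
theorem pinnedSum_congr_deg {𝕜 : Type*} [RCLike 𝕜] (wt : Γ → ℝ) {k k' : ℕ} (h : k = k')
    (φ : (Fin k → Γ) → 𝕜) (p : Fin k') (x : Γ) :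
    ∑ W ∈ Finset.univ.filter (fun W : Fin k' → Γ => W p = x),
        (∏ q, wt (W q)) * ‖φ (fun i => W (Fin.cast h i))‖ =
      ∑ W ∈ Finset.univ.filter (fun W : Fin k → Γ => W (Fin.cast h.symm p) = x), (∏ q, wt (W q)) * ‖φ W‖ := by
  subst h; rfl

/-! ### The bilinear term as a sum of presented tensor products -/

/-- `presented` of a double sum of presentations (lambda form). [folklore] -/
theorem presented_sum_sum {k : ℕ} (g : Γ → Γ → (Fin k → Γ) → R) :
    presented R (fun W => ∑ X, ∑ Y, g X Y W) = ∑ X, ∑ Y, presented R (g X Y) := by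
  have h1 : (fun W => ∑ X, ∑ Y, g X Y W) = ∑ X, ∑ Y, g X Y := by funext W; simp only [Finset.sum_apply]
  rw [h1, presented_sum]
  exact Finset.sum_congr rfl fun X _ => presented_sum _ _

omit [DecidableEq Γ] in
/-- Reordering a fourfold sum: the two label sums inside, the two degree sums outside. [folklore] -/
theorem sum_four_comm {M : Type*} [AddCommMonoid M] (s t : Finset ℕ) (f : Γ → Γ → ℕ → ℕ → M) :
    ∑ X, ∑ Y, ∑ a ∈ s, ∑ b ∈ t, f X Y a b = ∑ a ∈ s, ∑ b ∈ t, ∑ X, ∑ Y, f X Y a b := by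
  calc ∑ X, ∑ Y, ∑ a ∈ s, ∑ b ∈ t, f X Y a b = ∑ X, ∑ a ∈ s, ∑ Y, ∑ b ∈ t, f X Y a b :=
        Finset.sum_congr rfl fun X _ => Finset.sum_comm
    _ = ∑ a ∈ s, ∑ X, ∑ Y, ∑ b ∈ t, f X Y a b := Finset.sum_comm
    _ = ∑ a ∈ s, ∑ X, ∑ b ∈ t, ∑ Y, f X Y a b :=
        Finset.sum_congr rfl fun a _ => Finset.sum_congr rfl fun X _ => Finset.sum_comm
    _ = ∑ a ∈ s, ∑ b ∈ t, ∑ X, ∑ Y, f X Y a b := Finset.sum_congr rfl fun a _ => Finset.sum_comm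

variable [Algebra ℚ R]

/-- The left derivative of a Grassmann polynomial, expanded in presented kernels with the closed form of
`KernelCalculus.kernel_grassmannDeriv`: `∂_X F = Σ_a Σ_U (a+1) · kernel F (a+1) (X, U) ψ(U)`. [cite: Salmhofer1998, §3.2 (3.12)] -/
theorem grassmannDeriv_eq_sum_presented (F : GrassmannAlgebra R Γ) (X : Γ) :
    grassmannDeriv R X F = ∑ a ∈ Finset.range (Fintype.card Γ + 1),
      presented R (fun U : Fin a → Γ => ((a + 1 : ℕ) : R) * kernel R F (a + 1) (Fin.cons X U)) := by
  conv_lhs => rw [KernelExpansion.eq_sum_presented_kernel (grassmannDeriv R X F)]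
  refine Finset.sum_congr rfl fun a _ => ?_
  congr 1
  funext U
  exact KernelCalculus.kernel_grassmannDeriv F X a U

/-- **The bilinear term of Polchinski's equation as a double sum of presented tensor products**:
`Σ_{X,Y} C(X,Y) ∂_X F · ∂_Y G = Σ_{a,b} presented (T_{ab})` with
`T_{ab}(W) = Σ_{X,Y} C(X,Y) · (a+1) kernel F (a+1) (X, W₁) · (b+1) kernel G (b+1) (Y, W₂)`, `W = W₁ ⧺ W₂`.
[cite: Salmhofer1998, §4.1] -/
theorem bilinear_eq_sum_presented (C : Matrix Γ Γ R) (F G : GrassmannAlgebra R Γ) :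
    ∑ X, ∑ Y, C X Y • (grassmannDeriv R X F * grassmannDeriv R Y G) =
      ∑ a ∈ Finset.range (Fintype.card Γ + 1), ∑ b ∈ Finset.range (Fintype.card Γ + 1),
        presented R (fun W : Fin (a + b) → Γ => ∑ X, ∑ Y, C X Y *
          ((((a + 1 : ℕ) : R) * kernel R F (a + 1) (Fin.cons X fun i => W (Fin.castAdd b i))) *
            (((b + 1 : ℕ) : R) * kernel R G (b + 1) (Fin.cons Y fun j => W (Fin.natAdd a j))))) := by
  -- expand both derivatives and multiply out, for each `(X, Y)`
  have hXY : ∀ X Y, C X Y • (grassmannDeriv R X F * grassmannDeriv R Y G) =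
      ∑ a ∈ Finset.range (Fintype.card Γ + 1), ∑ b ∈ Finset.range (Fintype.card Γ + 1),
        presented R (fun W : Fin (a + b) → Γ => C X Y *
          ((((a + 1 : ℕ) : R) * kernel R F (a + 1) (Fin.cons X fun i => W (Fin.castAdd b i))) *
            (((b + 1 : ℕ) : R) * kernel R G (b + 1) (Fin.cons Y fun j => W (Fin.natAdd a j))))) := by
    intro X Y
    rw [grassmannDeriv_eq_sum_presented F X, grassmannDeriv_eq_sum_presented G Y, Finset.sum_mul_sum,
      Finset.smul_sum]
    refine Finset.sum_congr rfl fun a _ => ?_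
    rw [Finset.smul_sum]
    refine Finset.sum_congr rfl fun b _ => ?_
    rw [presented_mul_presented, ← KernelExpansion.presented_smul]
    rfl
  -- collect the `(X, Y)` sums inside the presentations
  refine (Finset.sum_congr rfl fun X _ => Finset.sum_congr rfl fun Y _ => hXY X Y).trans ?_
  refine (sum_four_comm _ _ _).trans ?_
  exact Finset.sum_congr rfl fun a _ => Finset.sum_congr rfl fun b _ => (presented_sum_sum _).symm

/-! ### Norm bookkeeping -/

/-- Enlarging the index box of the degree double sum: the constraint `a + b = n + 1` forces `a, b ≤ n + 1`,
so the terms with `a, b ≤ N` are among those with `a, b ≤ n + 1` (nonnegative terms). [folklore] -/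
theorem sum_ite_le_sum_ite (N n : ℕ) (t : ℕ → ℕ → ℝ) (ht : ∀ a b, 0 ≤ t a b) :
    ∑ a ∈ Finset.range (N + 1), ∑ b ∈ Finset.range (N + 1), (if a + b = n + 1 then t a b else 0) ≤
      ∑ a ∈ Finset.range (n + 2), ∑ b ∈ Finset.range (n + 2), (if a + b = n + 1 then t a b else 0) := by
  rw [← Finset.sum_product', ← Finset.sum_product', ← Finset.sum_filter, ← Finset.sum_filter]
  refine Finset.sum_le_sum_of_subset_of_nonneg (fun ab hab => ?_) fun ab _ _ => ht ab.1 ab.2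
  simp only [Finset.mem_filter, Finset.mem_product, Finset.mem_range] at hab ⊢
  omega

variable {𝕜 : Type*} [RCLike 𝕜]

/-- **Block bound**: the weighted pinned sums of the block function `U ↦ (a+1) · kernel F (a+1) U` are at most
`(a+1) · ε · ‖F_{a+1}‖_{wt,ε}` (Salmhofer's kernels carry `ε^{-(a+1)}`, the norm carries `ε^a`). [folklore] -/
theorem pinnedSum_block_le (wt : Γ → ℝ) {ε : ℝ} (hε : 0 < ε) (F : GrassmannAlgebra 𝕜 Γ)
    (a : ℕ) (p : Fin (a + 1)) (x : Γ) :
    ∑ U ∈ Finset.univ.filter (fun U : Fin (a + 1) → Γ => U p = x),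
        (∏ q, wt (U q)) * ‖((a + 1 : ℕ) : 𝕜) * kernel 𝕜 F (a + 1) U‖ ≤
      ((a + 1 : ℕ) : ℝ) * (ε * legKernelNorm wt ε (a + 1) (weightedKernel ε F (a + 1))) := by
  have hsum : ∑ U ∈ Finset.univ.filter (fun U : Fin (a + 1) → Γ => U p = x),
      (∏ q, wt (U q)) * ‖((a + 1 : ℕ) : 𝕜) * kernel 𝕜 F (a + 1) U‖ =
      ((a + 1 : ℕ) : ℝ) * (ε ^ (a + 1) * ∑ U ∈ Finset.univ.filter (fun U : Fin (a + 1) → Γ => U p = x),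
        (∏ q, wt (U q)) * ‖weightedKernel ε F (a + 1) U‖) := by
    rw [LaplacianNormBound.sum_weightedKernel wt hε.le, ← mul_assoc (ε ^ (a + 1)), ← mul_pow,
      mul_inv_cancel₀ hε.ne', one_pow, one_mul, Finset.mul_sum]
    refine Finset.sum_congr rfl fun U _ => ?_
    rw [norm_mul, RCLike.norm_natCast]
    ring
  rw [hsum, pow_succ', mul_assoc ε]
  exact mul_le_mul_of_nonneg_left (mul_le_mul_of_nonneg_left
    (LegKernelNormAlgebra.pinnedSum_le_legKernelNorm wt ε a _ p x) hε.le) (Nat.cast_nonneg _)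

/-! ### The tensor block of degrees `(a, b)` -/

end PolchinskiBilinearBound

namespace PolchinskiBilinearBound

variable {Γ : Type} [Fintype Γ] [DecidableEq Γ]

/-- **The `(a, b)` block estimate**: for `a + b = n + 1`, the weighted pinned sums of the antisymmetrised kernel of
the presented tensor block `T_{ab}` are at most `ε · cD · (a+1)(b+1) · ‖F_{a+1}‖ · ‖G_{b+1}‖` — antisymmetrisation is
norm-non-increasing (`legKernelNorm_kernel_presented_le`), then the tree-line estimate `stub_pinnedSumContractedTensorLe`
with the block bounds `pinnedSum_block_le`. [cite: Salmhofer1998, §4.1] -/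
theorem pinnedSum_kernel_block_le {wt : Γ → ℝ} (hwt : ∀ X, 0 ≤ wt X) {ε : ℝ} (hε : 0 < ε)
    (C : Matrix Γ Γ ℂ) (D : Γ → Γ → ℝ) (hD : ∀ X Y, 0 ≤ D X Y) (hC : ∀ X Y, ‖C X Y‖ ≤ wt X * wt Y * D X Y)
    {cD : ℝ} (hcD : 0 ≤ cD) (hR : ∀ X, ε * ∑ Y, D X Y ≤ cD) (hCo : ∀ Y, ε * ∑ X, D X Y ≤ cD)
    (F G : GrassmannAlgebra ℂ Γ) {a b n : ℕ} (h : a + b = n + 1) (p : Fin (n + 1)) (x : Γ) :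
    ∑ W ∈ Finset.univ.filter (fun W : Fin (n + 1) → Γ => W p = x), (∏ q, wt (W q)) *
        ‖kernel ℂ (presented ℂ (fun W : Fin (a + b) → Γ => ∑ X, ∑ Y, C X Y *
          ((((a + 1 : ℕ) : ℂ) * kernel ℂ F (a + 1) (Fin.cons X fun i => W (Fin.castAdd b i))) *
            (((b + 1 : ℕ) : ℂ) * kernel ℂ G (b + 1) (Fin.cons Y fun j => W (Fin.natAdd a j)))))) (n + 1) W‖ ≤
      ε * cD * (((a + 1) * (b + 1) : ℕ) : ℝ) *
        (legKernelNorm wt ε (a + 1) (weightedKernel ε F (a + 1)) *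
          legKernelNorm wt ε (b + 1) (weightedKernel ε G (b + 1))) := by
  -- abbreviations
  set NF : ℝ := legKernelNorm wt ε (a + 1) (weightedKernel ε F (a + 1)) with hNF
  set NG : ℝ := legKernelNorm wt ε (b + 1) (weightedKernel ε G (b + 1)) with hNG
  set T : (Fin (a + b) → Γ) → ℂ := fun W => ∑ X, ∑ Y, C X Y *
    ((((a + 1 : ℕ) : ℂ) * kernel ℂ F (a + 1) (Fin.cons X fun i => W (Fin.castAdd b i))) *
      (((b + 1 : ℕ) : ℂ) * kernel ℂ G (b + 1) (Fin.cons Y fun j => W (Fin.natAdd a j)))) with hT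
  have hNF0 : 0 ≤ NF := legKernelNorm_nonneg hwt hε.le _ _
  have hNG0 : 0 ≤ NG := legKernelNorm_nonneg hwt hε.le _ _
  set M : ℝ := ε * cD * (((a + 1) * (b + 1) : ℕ) : ℝ) * (NF * NG) with hM
  have hM0 : 0 ≤ M := by positivity
  -- the tree-line estimate for the pinned sums of `T`
  have hTp : ∀ (p' : Fin (a + b)) (w : Γ),
      ∑ W ∈ Finset.univ.filter (fun W : Fin (a + b) → Γ => W p' = w), (∏ q, wt (W q)) * ‖T W‖ ≤ M := by
    intro p' w
    have hrow : ∀ X, ∑ Y, D X Y ≤ cD / ε := fun X => by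
      rw [le_div_iff₀ hε, mul_comm]; exact hR X
    have hcol : ∀ Y, ∑ X, D X Y ≤ cD / ε := fun Y => by
      rw [le_div_iff₀ hε, mul_comm]; exact hCo Y
    refine (stub_pinnedSumContractedTensorLe wt hwt a b
      (fun U => ((a + 1 : ℕ) : ℂ) * kernel ℂ F (a + 1) U) (fun V => ((b + 1 : ℕ) : ℂ) * kernel ℂ G (b + 1) V)
      C D hD hC _ _ _ _ (pinnedSum_block_le wt hε F a) (pinnedSum_block_le wt hε G b) hrow hcol p' w).trans ?_
    rw [max_self, hM]
    refine le_of_eq ?_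
    push_cast
    field_simp
    ring
  -- transport to degree `n + 1` and antisymmetrise
  rw [presented_congr_deg h T]
  set T' : (Fin (n + 1) → Γ) → ℂ := fun W => T fun i => W (Fin.cast h i) with hT'
  have hT'norm : legKernelNorm wt ε (n + 1) T' ≤ ε ^ n * M := by
    refine LegKernelNormAlgebra.legKernelNorm_succ_le_of_forall wt ε n T' (by positivity) fun p' x' => ?_
    refine mul_le_mul_of_nonneg_left ?_ (pow_nonneg hε.le n)
    rw [hT', pinnedSum_congr_deg wt h T p' x']
    exact hTp _ _
  have hker : legKernelNorm wt ε (n + 1) (kernel ℂ (presented ℂ T') (n + 1)) ≤ ε ^ n * M :=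
    (LegKernelNormPresented.legKernelNorm_kernel_presented_le hwt hε.le (n + 1) T').trans hT'norm
  have hpin := LegKernelNormAlgebra.pinnedSum_le_legKernelNorm wt ε n (kernel ℂ (presented ℂ T') (n + 1)) p x
  have hεn : 0 < ε ^ n := pow_pos hε n
  calc ∑ W ∈ Finset.univ.filter (fun W : Fin (n + 1) → Γ => W p = x),
        (∏ q, wt (W q)) * ‖kernel ℂ (presented ℂ T') (n + 1) W‖
      = (ε ^ n)⁻¹ * (ε ^ n * ∑ W ∈ Finset.univ.filter (fun W : Fin (n + 1) → Γ => W p = x),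
          (∏ q, wt (W q)) * ‖kernel ℂ (presented ℂ T') (n + 1) W‖) := by
        rw [← mul_assoc, inv_mul_cancel₀ hεn.ne', one_mul]
    _ ≤ (ε ^ n)⁻¹ * (ε ^ n * M) :=
        mul_le_mul_of_nonneg_left (hpin.trans hker) (inv_nonneg.2 hεn.le)
    _ = M := by rw [← mul_assoc, inv_mul_cancel₀ hεn.ne', one_mul]

/-! ### The estimate -/

/-- **The `L¹–L^∞` estimate for the bilinear term of Polchinski's equation** (labels in `Type`, scalars `ℂ`):
for nonnegative leg weights, `ε > 0`, a covariance dominated leg-wise by `‖C X Y‖ ≤ wt X · wt Y · D X Y` with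
`ε`-weighted row and column sums of `D` at most `cD`,
`‖(Σ_{X,Y} C(X,Y) ∂_X F ∂_Y G)_{n+1}‖_{wt,ε} ≤ cD · Σ_{a+b=n+1} (a+1)(b+1) ‖F_{a+1}‖_{wt,ε} ‖G_{b+1}‖_{wt,ε}`
in Salmhofer's kernels `weightedKernel ε` (Salmhofer 1998, §4.1, Lemma 1: one tree line, `L¹` norm of the
propagator, `L¹–L^∞` norms of the two vertices, and the leg-counting factor `(a+1)(b+1)`). [cite: Salmhofer1998, §4.1] -/
theorem legKernelNorm_polchinskiBilinear_le {wt : Γ → ℝ} (hwt : ∀ X, 0 ≤ wt X) {ε : ℝ} (hε : 0 < ε)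
    (C : Matrix Γ Γ ℂ) (D : Γ → Γ → ℝ) (hD : ∀ X Y, 0 ≤ D X Y) (hC : ∀ X Y, ‖C X Y‖ ≤ wt X * wt Y * D X Y)
    (cD : ℝ) (hR : ∀ X, ε * ∑ Y, D X Y ≤ cD) (hCo : ∀ Y, ε * ∑ X, D X Y ≤ cD)
    (F G : GrassmannAlgebra ℂ Γ) (n : ℕ) :
    legKernelNorm wt ε (n + 1)
        (weightedKernel ε (∑ X, ∑ Y, C X Y • (grassmannDeriv ℂ X F * grassmannDeriv ℂ Y G)) (n + 1)) ≤
      cD * ∑ a ∈ Finset.range (n + 2), ∑ b ∈ Finset.range (n + 2),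
        (if a + b = n + 1 then
          ((a + 1) * (b + 1) : ℝ) *
            (legKernelNorm wt ε (a + 1) (weightedKernel ε F (a + 1)) *
              legKernelNorm wt ε (b + 1) (weightedKernel ε G (b + 1)))
        else 0) := by
  rcases isEmpty_or_nonempty Γ with hΓ | hΓ
  · -- no labels: every positive-degree norm vanishes
    have hw : ∀ X : Γ, wt X = 0 := fun X => isEmptyElim X
    rw [LaplacianNormBound.legKernelNorm_succ_eq_zero_of_wt (𝕜 := ℂ) hw]
    have hF : ∀ a, legKernelNorm wt ε (a + 1) (weightedKernel ε F (a + 1)) = 0 := fun a =>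
      LaplacianNormBound.legKernelNorm_succ_eq_zero_of_wt (𝕜 := ℂ) hw ε a _
    simp only [hF, zero_mul, mul_zero, ite_self, Finset.sum_const_zero, le_refl]
  obtain ⟨x₀⟩ := hΓ
  have hcD : 0 ≤ cD := (mul_nonneg hε.le (Finset.sum_nonneg fun Y _ => hD x₀ Y)).trans (hR x₀)
  -- the summands of the right-hand side are nonnegative
  set t : ℕ → ℕ → ℝ := fun a b => ((a + 1) * (b + 1) : ℝ) *
    (legKernelNorm wt ε (a + 1) (weightedKernel ε F (a + 1)) *
      legKernelNorm wt ε (b + 1) (weightedKernel ε G (b + 1))) with ht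
  have ht0 : ∀ a b, 0 ≤ t a b := fun a b =>
    mul_nonneg (by positivity) (mul_nonneg (legKernelNorm_nonneg hwt hε.le _ _) (legKernelNorm_nonneg hwt hε.le _ _))
  have hite0 : ∀ a b, 0 ≤ (if a + b = n + 1 then t a b else 0) := fun a b => by
    split_ifs
    · exact ht0 a b
    · exact le_rfl
  refine LegKernelNormAlgebra.legKernelNorm_succ_le_of_forall wt ε n _
    (mul_nonneg hcD (Finset.sum_nonneg fun a _ => Finset.sum_nonneg fun b _ => hite0 a b)) fun p x => ?_
  -- the kernels of the bilinear term, block by block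
  set N := Fintype.card Γ with hN
  have hker : ∀ W : Fin (n + 1) → Γ,
      kernel ℂ (∑ X, ∑ Y, C X Y • (grassmannDeriv ℂ X F * grassmannDeriv ℂ Y G)) (n + 1) W =
        ∑ a ∈ Finset.range (N + 1), ∑ b ∈ Finset.range (N + 1),
          kernel ℂ (presented ℂ (fun W : Fin (a + b) → Γ => ∑ X, ∑ Y, C X Y *
            ((((a + 1 : ℕ) : ℂ) * kernel ℂ F (a + 1) (Fin.cons X fun i => W (Fin.castAdd b i))) *
              (((b + 1 : ℕ) : ℂ) * kernel ℂ G (b + 1) (Fin.cons Y fun j => W (Fin.natAdd a j)))))) (n + 1) W := by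
    intro W
    rw [bilinear_eq_sum_presented, kernel_sum]
    exact Finset.sum_congr rfl fun a _ => kernel_sum ℂ _ _ _ _
  -- each block contributes at most `ε · cD · t a b` if `a + b = n + 1`, and nothing otherwise
  have hblock : ∀ a b, ∑ W ∈ Finset.univ.filter (fun W : Fin (n + 1) → Γ => W p = x), (∏ q, wt (W q)) *
      ‖kernel ℂ (presented ℂ (fun W : Fin (a + b) → Γ => ∑ X, ∑ Y, C X Y *
          ((((a + 1 : ℕ) : ℂ) * kernel ℂ F (a + 1) (Fin.cons X fun i => W (Fin.castAdd b i))) *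
            (((b + 1 : ℕ) : ℂ) * kernel ℂ G (b + 1) (Fin.cons Y fun j => W (Fin.natAdd a j)))))) (n + 1) W‖ ≤
      if a + b = n + 1 then ε * (cD * t a b) else 0 := by
    intro a b
    by_cases hab : a + b = n + 1
    · rw [if_pos hab]
      refine (pinnedSum_kernel_block_le hwt hε C D hD hC hcD hR hCo F G hab p x).trans (le_of_eq ?_)
      rw [ht]
      push_cast
      ring
    · rw [if_neg hab]
      refine (Finset.sum_eq_zero fun W _ => ?_).le
      rw [kernel_presented_of_ne ℂ _ W (Ne.symm hab), norm_zero, mul_zero]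
  -- sum the blocks
  have hsum : ∑ W ∈ Finset.univ.filter (fun W : Fin (n + 1) → Γ => W p = x), (∏ q, wt (W q)) *
      ‖kernel ℂ (∑ X, ∑ Y, C X Y • (grassmannDeriv ℂ X F * grassmannDeriv ℂ Y G)) (n + 1) W‖ ≤
      ∑ a ∈ Finset.range (N + 1), ∑ b ∈ Finset.range (N + 1), (if a + b = n + 1 then ε * (cD * t a b) else 0) := by
    calc ∑ W ∈ Finset.univ.filter (fun W : Fin (n + 1) → Γ => W p = x), (∏ q, wt (W q)) *
          ‖kernel ℂ (∑ X, ∑ Y, C X Y • (grassmannDeriv ℂ X F * grassmannDeriv ℂ Y G)) (n + 1) W‖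
        ≤ ∑ W ∈ Finset.univ.filter (fun W : Fin (n + 1) → Γ => W p = x),
            ∑ a ∈ Finset.range (N + 1), ∑ b ∈ Finset.range (N + 1), (∏ q, wt (W q)) *
              ‖kernel ℂ (presented ℂ (fun W : Fin (a + b) → Γ => ∑ X, ∑ Y, C X Y *
                ((((a + 1 : ℕ) : ℂ) * kernel ℂ F (a + 1) (Fin.cons X fun i => W (Fin.castAdd b i))) *
                  (((b + 1 : ℕ) : ℂ) * kernel ℂ G (b + 1) (Fin.cons Y fun j => W (Fin.natAdd a j)))))) (n + 1) W‖ := by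
          refine Finset.sum_le_sum fun W _ => ?_
          rw [hker W]
          refine (mul_le_mul_of_nonneg_left ((norm_sum_le _ _).trans (Finset.sum_le_sum fun a _ => norm_sum_le _ _))
            (Finset.prod_nonneg fun q _ => hwt _)).trans (le_of_eq ?_)
          rw [Finset.mul_sum]
          exact Finset.sum_congr rfl fun a _ => Finset.mul_sum _ _ _
      _ = ∑ a ∈ Finset.range (N + 1), ∑ b ∈ Finset.range (N + 1),
            ∑ W ∈ Finset.univ.filter (fun W : Fin (n + 1) → Γ => W p = x), (∏ q, wt (W q)) *
              ‖kernel ℂ (presented ℂ (fun W : Fin (a + b) → Γ => ∑ X, ∑ Y, C X Y *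
                ((((a + 1 : ℕ) : ℂ) * kernel ℂ F (a + 1) (Fin.cons X fun i => W (Fin.castAdd b i))) *
                  (((b + 1 : ℕ) : ℂ) * kernel ℂ G (b + 1) (Fin.cons Y fun j => W (Fin.natAdd a j)))))) (n + 1) W‖ := by
          rw [Finset.sum_comm]
          exact Finset.sum_congr rfl fun a _ => Finset.sum_comm
      _ ≤ _ := Finset.sum_le_sum fun a _ => Finset.sum_le_sum fun b _ => hblock a b
  -- bookkeeping: `ε^n · ε^{-(n+1)} · ε = 1`, and enlarge the index box
  rw [LaplacianNormBound.sum_weightedKernel wt hε.le]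
  have hεpow : ε ^ n * ε⁻¹ ^ (n + 1) * ε = 1 := by
    rw [pow_succ, ← mul_assoc, ← mul_pow, mul_inv_cancel₀ hε.ne', one_pow, one_mul, inv_mul_cancel₀ hε.ne']
  have hfac : ∑ a ∈ Finset.range (N + 1), ∑ b ∈ Finset.range (N + 1),
      (if a + b = n + 1 then ε * (cD * t a b) else 0) =
      ε * (cD * ∑ a ∈ Finset.range (N + 1), ∑ b ∈ Finset.range (N + 1), (if a + b = n + 1 then t a b else 0)) := by
    rw [Finset.mul_sum, Finset.mul_sum]
    refine Finset.sum_congr rfl fun a _ => ?_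
    rw [Finset.mul_sum, Finset.mul_sum]
    refine Finset.sum_congr rfl fun b _ => ?_
    split_ifs <;> simp
  calc ε ^ n * (ε⁻¹ ^ (n + 1) * ∑ W ∈ Finset.univ.filter (fun W : Fin (n + 1) → Γ => W p = x), (∏ q, wt (W q)) *
        ‖kernel ℂ (∑ X, ∑ Y, C X Y • (grassmannDeriv ℂ X F * grassmannDeriv ℂ Y G)) (n + 1) W‖)
      ≤ ε ^ n * (ε⁻¹ ^ (n + 1) * (ε * (cD * ∑ a ∈ Finset.range (N + 1), ∑ b ∈ Finset.range (N + 1),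
          (if a + b = n + 1 then t a b else 0)))) := by
        rw [← hfac]
        exact mul_le_mul_of_nonneg_left (mul_le_mul_of_nonneg_left hsum (pow_nonneg (inv_nonneg.2 hε.le) _))
          (pow_nonneg hε.le _)
    _ = cD * ∑ a ∈ Finset.range (N + 1), ∑ b ∈ Finset.range (N + 1), (if a + b = n + 1 then t a b else 0) := by
        rw [← mul_assoc, ← mul_assoc, hεpow, one_mul]
    _ ≤ cD * ∑ a ∈ Finset.range (n + 2), ∑ b ∈ Finset.range (n + 2), (if a + b = n + 1 then t a b else 0) :=
        mul_le_mul_of_nonneg_left (sum_ite_le_sum_ite N n t ht0) hcD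

end PolchinskiBilinearBound

/-! ### The registered stub -/

/-- **V2 (`stub_legKernelNormPolchinskiBilinearLe`)**: the `L¹–L^∞` estimate for the bilinear term
`Σ_{X,Y} Ċ(X,Y) ∂_X F ∂_Y G` of Polchinski's equation in the leg-weighted norm of the route's scale report:
`‖(Σ C ∂F ∂G)_{n+1}‖_{wt,ε} ≤ cD · Σ_{a+b=n+1} (a+1)(b+1) ‖F_{a+1}‖_{wt,ε} ‖G_{b+1}‖_{wt,ε}` (Salmhofer 1998, §4.1,
Lemma 1; Gawȩdzki–Kupiainen 1985, §3). [cite: Salmhofer1998, §4.1] -/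
theorem stub_legKernelNormPolchinskiBilinearLe :
    ∀ {Γ : Type} [Fintype Γ] [DecidableEq Γ] (wt : Γ → ℝ), (∀ X, 0 ≤ wt X) → ∀ {ε : ℝ}, 0 < ε →
      ∀ (C : Matrix Γ Γ ℂ) (D : Γ → Γ → ℝ), (∀ X Y, 0 ≤ D X Y) → (∀ X Y, ‖C X Y‖ ≤ wt X * wt Y * D X Y) →
        ∀ (cD : ℝ), (∀ X, ε * ∑ Y, D X Y ≤ cD) → (∀ Y, ε * ∑ X, D X Y ≤ cD) →
        ∀ (F G : GrassmannAlgebra ℂ Γ) (n : ℕ),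
          legKernelNorm wt ε (n + 1)
              (weightedKernel ε (∑ X, ∑ Y, C X Y • (grassmannDeriv ℂ X F * grassmannDeriv ℂ Y G)) (n + 1)) ≤
            cD * ∑ a ∈ Finset.range (n + 2), ∑ b ∈ Finset.range (n + 2),
              (if a + b = n + 1 then
                ((a + 1) * (b + 1) : ℝ) *
                  (legKernelNorm wt ε (a + 1) (weightedKernel ε F (a + 1)) *
                    legKernelNorm wt ε (b + 1) (weightedKernel ε G (b + 1)))
              else 0) := by
  intro Γ _ _ wt hwt ε hε C D hD hC cD hR hCo F G n
  exact PolchinskiBilinearBound.legKernelNorm_polchinskiBilinear_le hwt hε C D hD hC cD hR hCo F G n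

end Summit.HubbardSuperconductivity.HubbardSuperconductivity.Theorems.AposterioriCapRgSeededBrokenRegimeBoseFermiPinned
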